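import Summits.BirchSwinnertonDyer.Rank1Residual.X2.RankOneRegulatorBSD
import Literature.NumberTheory.EllipticCurves.Rank1Residual.Typed.PAdicCertificateEngine
import HarnessLib

/-!
# Class X2, sub-cell X2c (rank one): under Mazur's main conjecture at the pair, the `p`-adic
# certificate of lever L3 (with `#Ш_an`) is EXACT — `certificate ⟺ Schneider ∧ BSD(E,p)`
# (cell `b2b-bsdres`, unit `b2b-bsdres-eisenstein-p2`, gen 5)

HONEST FRAMING (run/shared/lean/b2b/bsd-rank1-residual/, verbatim in every file): the goal of the
cell is to DELETE the COMBINATION-SHAPED residual classes of the Birch–Swinnerton-Dyer formula for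
ALL analytic-rank `≤ 1` elliptic curves over `ℚ` — "full BSD formula for every rank `≤ 1` curve in
class `C`" assembled STRICTLY from published theorems — so that the rank-`≤ 1` remainder becomes
exactly the CONSTRUCTION-SHAPED classes, which are TYPED (missing-input `Prop`s), NOT attempted.
This is not "finishing BSD". Research route; NO CLAIM BEYOND STATED CLASSES; nothing here changes
a label; X2c stays CONSTRUCTION-SHAPED. Theorems only (no definition, no named fact).

WHAT. Lever L3 (`Typed.X2.bsdp_of_thm16mult_{split,nonsplit}_of_canonical_certificate`) closes a
rank-`≤ 1` X2 pair from Wuthrich's DIVISIBILITY `ϖ·L = ι(T^e·h·f_E)` plus the per-pair data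
`hordL : ord_{T=0} L = r + e` and `hcert : ord_p(ϖ·[T^{r+e}]L·B) = ord_p(A·Reg_p)` plus `p ∤ #Ш_an`:
the cofactor `h` contributes a defect `ord_p h(0) ≥ 0`, so divisibility gives only the inequality
`ord_p #Ш[p^∞] + ord_p(A·Reg_p) ≤ ord_p(ϖ·[T^{r+e}]L·B)` (`Typed.padicValNat_card_shaPrimary_le_of_leadingTerm_shape`).
Under MAZUR'S MAIN CONJECTURE AT THE PAIR (`X2.MazurMainConjectureAt W p`: `h` is a UNIT) the defect
vanishes and everything becomes an equivalence:

* `order_iff_and_shaValuation_eq_of_unit` (pure algebra, the engine with a unit cofactor):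
  `ord_{T=0} L = r + e ⟺ ord_{T=0} f_E = r`, and then
  `ord_p #Ш[p^∞] + ord_p(A·R) = ord_p(c·[T^{r+e}]L·B)` EXACTLY.
* `certificate_iff_schneider_and_bsdp_of_mazurMainConjectureAt_{split,nonsplit}`: at an X2 pair
  of analytic rank `≤ 1` with Mazur's MC, for THE Stein–Wuthrich §4.2 height `Dh` and the pair's
  rational `#Ш_an = s`:
  **`(ord_{T=0} L = r + e ∧ ord_p(ϖ·[T^{r+e}]L·B) = ord_p(A·Reg_p(E,Dh)) + ord_p s) ⟺
  (Schneider(Dh) ∧ BSD(E,p))`** (`A = 𝓛_p·∏c`, `B = log_p(κγ)^{r+1}·#tors²` split; `A = 2·∏c`,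
  `B = log_p(κγ)^r·#tors²` non-split; `r = rank E(ℚ)`; Jones = SW 2013 Thm. 6.1 clauses (1)–(3),
  Gross–Zagier–Kolyvagin for `rank = r_an` and `Ш` finite).
* Where the MC is available: per pair from gen 4/5's λ-certificates (`mazurMainConjectureAt_of_lamMin`,
  `…_of_routeP`, `…_of_routeP_rankOne`), and CLASS-LEVEL on the ψ-odd part of X2c — `GVPar W p` —
  by Greenberg–Vatsal at a multiplicative prime (`mazurMainConjectureAt_of_gvPar`, gen 1, flag
  `GV00-mult-asserted`): `certificate_iff_schneider_and_bsdp_of_gvPar_{split,nonsplit}`. So on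
  X2c ∧ ψ-odd (138 census pairs) the L3 certificate with `#Ш_an` is NECESSARY AND SUFFICIENT for
  `Schneider ∧ BSD(E,p)` modulo the flag: no per-pair route through Jones' formula can avoid the
  Schneider certificate, and none needs more than it.

References: [SteinWuthrich2013] Thm. 6.1 (p. 20), §4.2; [Wuthrich2014] Thm. 16; [GreenbergVatsal2000]
Thm. (1.3), pp. 14–15; [Miller2011LMS] Def. 1.1, Prop. 7.6; HOME/b2b-bsdres-eisenstein-p2/X2-GAP.md §10.
-/

set_option autoImplicit false

noncomputable section

open scoped Classical MatrixGroups ModularForm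

open PowerSeries CongruenceSubgroup WeierstrassCurve Literature.NumberTheory.EllipticCurves
  Literature.NumberTheory.EllipticCurves.ModularForms
  Literature.NumberTheory.EllipticCurves.Rank1Residual
  Literature.NumberTheory.EllipticCurves.Rank1Residual.Typed
  Literature.NumberTheory.EllipticCurves.GreenbergVatsal2000
  Literature.NumberTheory.EllipticCurves.Wuthrich2014
  Literature.NumberTheory.EllipticCurves.SteinWuthrich2013

namespace Summit.BirchSwinnertonDyer.Rank1Residual.X2

/-! ## §1. The engine with a UNIT cofactor (pure algebra) -/

section Engine

variable (W : WeierstrassCurve ℚ) (p : ℕ) [Fact p.Prime]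

/-- **The certificate engine with a unit cofactor.** Data: `fE ∈ Λ`, a unit `w ∈ Λˣ`, `c ≠ 0`,
`c·L = T^e·ι(fE·w)`, `T^k ∣ fE`, and the leading-term shape at order `k` (available once
`ord_{T=0} fE = k`). Then (i) `ord_{T=0} L = k + e ⟺ ord_{T=0} fE = k`; (ii) if `ord_{T=0} fE = k`,
`Ш[p^∞]` is finite, `R ≠ 0` and `ord_p #Ш[p^∞] + ord_p(A·R) = ord_p(c·[T^{k+e}]L·B)` — EQUALITY (the
divisibility-only engine `Typed.padicValNat_card_shaPrimary_le_of_leadingTerm_shape` gives `≤` with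
defect `ord_p h(0)`; here `h = w`, `h(0) ∈ ℤ_pˣ`). [cite: Miller2011LMS, Prop. 7.6] -/
theorem order_iff_and_shaValuation_eq_of_unit (fE : IwasawaAlgebra p) (w : (IwasawaAlgebra p)ˣ)
    (L : PowerSeries ℚ_[p]) (c : ℚ_[p]) (hc : c ≠ 0) (e k : ℕ)
    (hι : PowerSeries.C c * L = PowerSeries.X ^ e * iwasawaToPowerSeries p (fE * w))
    (A B R : ℚ_[p]) (hA : A ≠ 0) (hXk : (PowerSeries.X : IwasawaAlgebra p) ^ k ∣ fE)
    (hLT : fE.order = (k : ℕ) →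
      Finite (AddCommGroup.primaryComponent W.sha p) ∧ R ≠ 0 ∧
        ∃ u : ℤ_[p]ˣ, ((PowerSeries.coeff k fE : ℤ_[p]) : ℚ_[p]) * B =
          ((u : ℤ_[p]) : ℚ_[p]) *
            (A * R * (Nat.card (AddCommGroup.primaryComponent W.sha p) : ℚ_[p]))) :
    (L.order = (k + e : ℕ) ↔ fE.order = (k : ℕ)) ∧
      (fE.order = (k : ℕ) → Finite (AddCommGroup.primaryComponent W.sha p) ∧ R ≠ 0 ∧
        (padicValNat p (Nat.card (AddCommGroup.primaryComponent W.sha p)) : ℤ) +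
            (A * R).valuation = (c * PowerSeries.coeff (k + e) L * B).valuation) := by
  obtain ⟨q, hq⟩ := hXk
  -- the constant coefficient of the unit `w` is a unit of `ℤ_p`
  obtain ⟨w0, hw0⟩ := PowerSeries.isUnit_constantCoeff (w : IwasawaAlgebra p) w.isUnit
  -- coefficients: `[T^k] fE = q(0)`, `[T^k](fE·w) = q(0)·w(0)`, `c·[T^{k+e}]L = q(0)·w(0)`
  have hcoeff_fE : (PowerSeries.coeff k fE : ℤ_[p]) = PowerSeries.constantCoeff q := by
    rw [hq, PowerSeries.coeff_X_pow_mul', if_pos le_rfl, Nat.sub_self,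
      PowerSeries.coeff_zero_eq_constantCoeff]
  have hcoeff_g : (PowerSeries.coeff k (fE * w) : ℤ_[p]) =
      PowerSeries.constantCoeff q * (w0 : ℤ_[p]) := by
    rw [hq, mul_assoc, PowerSeries.coeff_X_pow_mul', if_pos le_rfl, Nat.sub_self,
      PowerSeries.coeff_zero_eq_constantCoeff, map_mul, hw0]
  have hcoeff_cL : ∀ i : ℕ, c * PowerSeries.coeff i L =
      PowerSeries.coeff i (PowerSeries.X ^ e * iwasawaToPowerSeries p (fE * w)) := by
    intro i
    rw [← PowerSeries.coeff_C_mul, hι]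
  have hcoeff_top : c * PowerSeries.coeff (k + e) L =
      ((PowerSeries.constantCoeff q : ℤ_[p]) : ℚ_[p]) * ((w0 : ℤ_[p]) : ℚ_[p]) := by
    rw [hcoeff_cL, PowerSeries.coeff_X_pow_mul', if_pos (Nat.le_add_left e k), Nat.add_sub_cancel,
      coeff_iwasawaToPowerSeries, hcoeff_g]
    push_cast; ring
  have hcoeff_low : ∀ i : ℕ, i < k + e → PowerSeries.coeff i L = 0 := by
    intro i hi
    have h0 : c * PowerSeries.coeff i L = 0 := by
      rw [hcoeff_cL, PowerSeries.coeff_X_pow_mul']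
      by_cases hei : e ≤ i
      · rw [if_pos hei, coeff_iwasawaToPowerSeries, hq, mul_assoc,
          PowerSeries.coeff_X_pow_mul', if_neg (by omega)]
        rfl
      · rw [if_neg hei]
    rcases mul_eq_zero.mp h0 with h | h
    · exact absurd h hc
    · exact h
  have hw0Q : ((w0 : ℤ_[p]) : ℚ_[p]) ≠ 0 := coe_units_ne_zero p w0
  -- (i) the order equivalence
  have horder_fE : fE.order = (k : ℕ) ↔ PowerSeries.constantCoeff q ≠ 0 := by
    constructor
    · intro hord hq0
      have hfE0 : fE ≠ 0 := by
        intro h0; rw [h0, PowerSeries.order_zero] at hord; exact ENat.top_ne_coe _ hord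
      have h1 := PowerSeries.coeff_order hfE0
      rw [hord, ENat.toNat_coe, hcoeff_fE] at h1
      exact h1 hq0
    · intro hq0
      refine le_antisymm (PowerSeries.order_le k (by rw [hcoeff_fE]; exact hq0)) ?_
      refine PowerSeries.le_order fE k (fun i hi => ?_)
      have hik : ¬ k ≤ i := not_le.mpr (by exact_mod_cast hi)
      rw [hq, PowerSeries.coeff_X_pow_mul', if_neg hik]
  have horder_L : L.order = (k + e : ℕ) ↔ PowerSeries.constantCoeff q ≠ 0 := by
    rw [PowerSeries.order_eq_nat]
    constructor
    · rintro ⟨hne, -⟩ hq0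
      apply hne
      have : c * PowerSeries.coeff (k + e) L = 0 := by rw [hcoeff_top, hq0]; push_cast; ring
      rcases mul_eq_zero.mp this with h | h
      · exact absurd h hc
      · exact h
    · intro hq0
      refine ⟨fun h0 => ?_, hcoeff_low⟩
      have hq0Q : ((PowerSeries.constantCoeff q : ℤ_[p]) : ℚ_[p]) ≠ 0 :=
        fun h ↦ hq0 (PadicInt.coe_eq_zero.mp h)
      have : c * PowerSeries.coeff (k + e) L ≠ 0 := by
        rw [hcoeff_top]
        exact mul_ne_zero hq0Q hw0Q
      exact this (by rw [h0, mul_zero])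
  refine ⟨horder_L.trans horder_fE.symm, fun hord => ?_⟩
  -- (ii) the exact identity
  obtain ⟨hfin, hR, u, hu⟩ := hLT hord
  refine ⟨hfin, hR, ?_⟩
  haveI := hfin
  set Shp : ℚ_[p] := (Nat.card (AddCommGroup.primaryComponent W.sha p) : ℚ_[p]) with hShp_def
  have key : c * PowerSeries.coeff (k + e) L * B =
      ((w0 : ℤ_[p]) : ℚ_[p]) * (((u : ℤ_[p]) : ℚ_[p]) * ((A * R) * Shp)) := by
    calc c * PowerSeries.coeff (k + e) L * B
        = ((w0 : ℤ_[p]) : ℚ_[p]) * (((PowerSeries.coeff k fE : ℤ_[p]) : ℚ_[p]) * B) := by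
          rw [hcoeff_top, hcoeff_fE]; ring
      _ = ((w0 : ℤ_[p]) : ℚ_[p]) * (((u : ℤ_[p]) : ℚ_[p]) * ((A * R) * Shp)) := by rw [hu, hShp_def]
  have hShp0 : Shp ≠ 0 := by rw [hShp_def]; exact_mod_cast Nat.card_pos.ne'
  have hAR0 : A * R ≠ 0 := mul_ne_zero hA hR
  have hval := congrArg Padic.valuation key
  rw [Padic.valuation_mul hw0Q (mul_ne_zero (coe_units_ne_zero p u) (mul_ne_zero hAR0 hShp0)),
    Padic.valuation_mul (coe_units_ne_zero p u) (mul_ne_zero hAR0 hShp0),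
    valuation_coe_units_eq_zero, valuation_coe_units_eq_zero, zero_add, zero_add,
    Padic.valuation_mul hAR0 hShp0] at hval
  have hvS : Shp.valuation =
      (padicValNat p (Nat.card (AddCommGroup.primaryComponent W.sha p)) : ℤ) := by
    rw [hShp_def, Padic.valuation_natCast]
  rw [← hvS, hval]; ring

end Engine

/-! ## §2. Under Mazur's MC at the pair: the L3 certificate with `#Ш_an` is exact -/

section Exact

variable {W : WeierstrassCurve ℚ} [W.IsElliptic] [W.IsGloballyMinimal] {p : ℕ} [Fact p.Prime]

/-- **SPLIT `p`: under `X2.MazurMainConjectureAt W p`, at analytic rank `≤ 1`, for THE §4.2 height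
`Dh` and the pair's rational `#Ш_an = s`:
`(ord_{T=0} L = r + 1 ∧ ord_p(ϖ·[T^{r+1}]L·log_p(κγ)^{r+1}·#tors²) = ord_p(𝓛_p·∏c·Reg_p(E,Dh)) + ord_p s)
⟺ (Reg_p(E,Dh) ≠ 0 ∧ BSD(E,p))`** (`r = rank E(ℚ) = r_an` by GZK `hGZK`; Jones `hJs`). The data
`κ, γ, f, D, ϖ, L` are those of the MC statement / of lever L3. [cite: SteinWuthrich2013, Thm. 6.1 (p. 20) and §4.2]
[cite: Miller2011LMS, Def. 1.1 and Prop. 7.6] -/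
theorem certificate_iff_schneider_and_bsdp_of_mazurMainConjectureAt_split
    (hJs : thm61_splitMultiplicative) (hGZK : rank_eq_analyticRank_of_analyticRank_le_one)
    (W : WeierstrassCurve ℚ) [W.IsElliptic] [W.IsGloballyMinimal] (p : ℕ) [Fact p.Prime]
    (hp2 : p ≠ 2) (hr : W.analyticRank ≤ 1) (hMC : X2.MazurMainConjectureAt W p)
    (Dq : TateParameterData W p) {Dh : PAdicHeightData W p} (hDh : IsSplitMultCanonical Dh Dq)
    {κ : ZpExtension ℚ p} {γ : Field.absoluteGaloisGroup ℚ} (hκ : κ.IsCyclotomic)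
    (hγ : κ.IsTopGenerator γ) (hγ' : IsCyclotomicVariable p γ) {N : ℕ} [NeZero N]
    {f : CuspForm (Gamma0 N) 2} (hf : IsNewformOf W f) (D : W.SelmerDualData κ γ) (ϖ : ℚ)
    (hϖ0 : ϖ ≠ 0) (hϖ : (ϖ : ℝ) * W.realPeriodRat = plusPeriod f)
    (L : PowerSeries ℚ_[p]) (hL : IsSplitMultPAdicLFunctionOf f p L) {s : ℚ} (hs : shaAn W = (s : ℂ)) :
    (L.order = (W.mordellWeilRank + 1 : ℕ) ∧
      (((ϖ : ℚ) : ℚ_[p]) * PowerSeries.coeff (W.mordellWeilRank + 1) L *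
          (padicLog p (cyclotomicGenerator p) ^ (W.mordellWeilRank + 1) *
            (W.torsionOrder : ℚ_[p]) ^ 2)).valuation =
        (LInvariant Dq * (W.tamagawaProduct : ℚ_[p]) * padicRegulator Dh).valuation + padicValRat p s)
    ↔ (SchneiderConjecture Dh ∧ BSDp W p) := by
  haveI : Module.Finite (IwasawaAlgebra p) D.X := D.module_finite_holds hγ
  obtain ⟨hX, g, hchar, hsp, -⟩ := hMC κ γ hκ hγ hγ' f hf D ϖ hϖ
  obtain ⟨w, hw⟩ := hsp Dq.split L hL
  have hι : PowerSeries.C ((ϖ : ℚ) : ℚ_[p]) * L =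
      PowerSeries.X ^ 1 * iwasawaToPowerSeries p (g * w) := by
    rw [← hw, pow_one, mul_assoc, map_mul]
    simp [iwasawaToPowerSeries, PowerSeries.map_X]
  obtain ⟨hrank, hfinsha⟩ := hGZK W hr
  haveI : Finite W.sha := hfinsha
  have hfinp : Finite (AddCommGroup.primaryComponent W.sha p) := inferInstance
  have hϖQ : ((ϖ : ℚ) : ℚ_[p]) ≠ 0 := by exact_mod_cast hϖ0
  have hc0 : (W.tamagawaProduct : ℚ_[p]) ≠ 0 := by exact_mod_cast (W.tamagawaProduct_pos').ne'
  have hA0 : LInvariant Dq * (W.tamagawaProduct : ℚ_[p]) ≠ 0 :=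
    mul_ne_zero (LInvariant_ne_zero_holds Dq) hc0
  have hXk := thm61_splitMultiplicative.X_pow_dvd hJs hp2 Dq hκ hγ hγ' D hX hDh hchar
  have hS2 := thm61_splitMultiplicative.order_eq_iff hJs hp2 Dq hκ hγ hγ' D hX hDh hchar
  obtain ⟨hord, hid⟩ := order_iff_and_shaValuation_eq_of_unit W p g w L _ hϖQ 1 W.mordellWeilRank hι
    _ _ (padicRegulator Dh) hA0 hXk (hJs.leadingTerm_shape hp2 Dq hκ hγ hγ' D hX hDh g hchar)
  have hbsd := bsdp_iff_padicValRat_eq_of_shaAn_eq W p hrank hfinp hs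
  constructor
  · rintro ⟨hordL, hcert⟩
    have hordg : g.order = (W.mordellWeilRank : ℕ) := hord.mp hordL
    obtain ⟨hSch, -⟩ := hS2.mp hordg
    obtain ⟨-, -, hval⟩ := hid hordg
    refine ⟨hSch, hbsd.mpr ?_⟩
    linarith
  · rintro ⟨hSch, hB⟩
    have hordg : g.order = (W.mordellWeilRank : ℕ) := hS2.mpr ⟨hSch, hfinp⟩
    obtain ⟨-, -, hval⟩ := hid hordg
    refine ⟨hord.mpr hordg, ?_⟩
    have := hbsd.mp hB
    linarith

/-- **NON-SPLIT `p`: under `X2.MazurMainConjectureAt W p`, at analytic rank `≤ 1`: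
`(ord_{T=0} L = r ∧ ord_p(ϖ·[T^r]L·log_p(κγ)^r·#tors²) = ord_p(2·∏c·Reg_p(E,Dh)) + ord_p s)
⟺ (Reg_p(E,Dh) ≠ 0 ∧ BSD(E,p))`** for THE §4.2 height (formula (4.1), `IsMultCanonical Dh q`).
[cite: SteinWuthrich2013, Thm. 6.1 (p. 20), §3.1 (p. 9), §4.2] [cite: Miller2011LMS, Def. 1.1 and Prop. 7.6] -/
theorem certificate_iff_schneider_and_bsdp_of_mazurMainConjectureAt_nonsplit
    (hJn : thm61_nonsplitMultiplicative) (hGZK : rank_eq_analyticRank_of_analyticRank_le_one)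
    (W : WeierstrassCurve ℚ) [W.IsElliptic] [W.IsGloballyMinimal] (p : ℕ) [Fact p.Prime]
    (hp2 : p ≠ 2) (hr : W.analyticRank ≤ 1) (hMC : X2.MazurMainConjectureAt W p)
    (hmult : W.HasMultiplicativeReductionAtPrime p) (hns : ¬ W.HasSplitMultiplicativeReductionAtPrime p)
    {q : ℚ_[p]} (hq0 : q ≠ 0) (hq1 : ‖q‖ < 1) (hqj : tateJ q = (W.j : ℚ_[p]))
    {Dh : PAdicHeightData W p} (hDh : IsMultCanonical Dh q)
    {κ : ZpExtension ℚ p} {γ : Field.absoluteGaloisGroup ℚ} (hκ : κ.IsCyclotomic)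
    (hγ : κ.IsTopGenerator γ) (hγ' : IsCyclotomicVariable p γ) {N : ℕ} [NeZero N]
    {f : CuspForm (Gamma0 N) 2} (hf : IsNewformOf W f) (D : W.SelmerDualData κ γ) (ϖ : ℚ)
    (hϖ0 : ϖ ≠ 0) (hϖ : (ϖ : ℝ) * W.realPeriodRat = plusPeriod f)
    (L : PowerSeries ℚ_[p]) (hL : IsMultPAdicLFunctionOf f p (-1) L) {s : ℚ}
    (hs : shaAn W = (s : ℂ)) :
    (L.order = (W.mordellWeilRank : ℕ) ∧
      (((ϖ : ℚ) : ℚ_[p]) * PowerSeries.coeff W.mordellWeilRank L *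
          (padicLog p (cyclotomicGenerator p) ^ W.mordellWeilRank *
            (W.torsionOrder : ℚ_[p]) ^ 2)).valuation =
        (2 * (W.tamagawaProduct : ℚ_[p]) * padicRegulator Dh).valuation + padicValRat p s)
    ↔ (SchneiderConjecture Dh ∧ BSDp W p) := by
  haveI : Module.Finite (IwasawaAlgebra p) D.X := D.module_finite_holds hγ
  obtain ⟨hX, g, hchar, -, hnsp⟩ := hMC κ γ hκ hγ hγ' f hf D ϖ hϖ
  obtain ⟨w, hw⟩ := hnsp hns L hL
  have hι : PowerSeries.C ((ϖ : ℚ) : ℚ_[p]) * L =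
      PowerSeries.X ^ 0 * iwasawaToPowerSeries p (g * w) := by
    rw [← hw, pow_zero, one_mul]
  obtain ⟨hrank, hfinsha⟩ := hGZK W hr
  haveI : Finite W.sha := hfinsha
  have hfinp : Finite (AddCommGroup.primaryComponent W.sha p) := inferInstance
  have hϖQ : ((ϖ : ℚ) : ℚ_[p]) ≠ 0 := by exact_mod_cast hϖ0
  have hc0 : (W.tamagawaProduct : ℚ_[p]) ≠ 0 := by exact_mod_cast (W.tamagawaProduct_pos').ne'
  have hA0 : (2 : ℚ_[p]) * (W.tamagawaProduct : ℚ_[p]) ≠ 0 := mul_ne_zero two_ne_zero hc0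
  have hXk := thm61_nonsplitMultiplicative.X_pow_dvd hJn hp2 hmult hns hq0 hq1 hqj hκ hγ hγ' D hX
    hDh hchar
  have hS2 := thm61_nonsplitMultiplicative.order_eq_iff hJn hp2 hmult hns hq0 hq1 hqj hκ hγ hγ' D
    hX hDh hchar
  obtain ⟨hord, hid⟩ := order_iff_and_shaValuation_eq_of_unit W p g w L _ hϖQ 0 W.mordellWeilRank hι
    _ _ (padicRegulator Dh) hA0 hXk
    (hJn.leadingTerm_shape hp2 hmult hns hq0 hq1 hqj hκ hγ hγ' D hX hDh g hchar)
  have hbsd := bsdp_iff_padicValRat_eq_of_shaAn_eq W p hrank hfinp hs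
  rw [Nat.add_zero] at hord hid
  constructor
  · rintro ⟨hordL, hcert⟩
    have hordg : g.order = (W.mordellWeilRank : ℕ) := hord.mp hordL
    obtain ⟨hSch, -⟩ := hS2.mp hordg
    obtain ⟨-, -, hval⟩ := hid hordg
    refine ⟨hSch, hbsd.mpr ?_⟩
    linarith
  · rintro ⟨hSch, hB⟩
    have hordg : g.order = (W.mordellWeilRank : ℕ) := hS2.mpr ⟨hSch, hfinp⟩
    obtain ⟨-, -, hval⟩ := hid hordg
    refine ⟨hord.mpr hordg, ?_⟩
    have := hbsd.mp hB
    linarith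

/-! ## §3. On X2c ∧ ψ-odd (`GVPar`): exactness CLASS-LEVEL modulo the flag `GV00-mult-asserted` -/

/-- **X2 ∧ `GVPar`, split `p`, analytic rank `≤ 1`: the L3 certificate (with `#Ш_an`) is EXACT**
— Mazur's MC at the pair from Greenberg–Vatsal at a multiplicative prime (`hGV`, flag
`GV00-mult-asserted`) + Wuthrich Thm. 16 (`hWu`) via gen 1's `mazurMainConjectureAt_of_gvPar`, then
`certificate_iff_schneider_and_bsdp_of_mazurMainConjectureAt_split`. Per pair in its data, class-level
in its hypotheses; X2c stays CONSTRUCTION-SHAPED. [cite: GreenbergVatsal2000, Thm. (1.3) with pp. 1, 14–15]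
[cite: Wuthrich2014, Thm. 16 (p. 397)] [cite: SteinWuthrich2013, Thm. 6.1 (p. 20) and §4.2] -/
theorem certificate_iff_schneider_and_bsdp_of_gvPar_split (hGV : lambdaMu_multiplicative_of_gvPar)
    (hWu : thm16_charIdeal_dvd_multiplicative_of_reducible)
    (hJs : thm61_splitMultiplicative) (hGZK : rank_eq_analyticRank_of_analyticRank_le_one)
    (W : WeierstrassCurve ℚ) [W.IsElliptic] [W.IsGloballyMinimal] (p : ℕ) [Fact p.Prime]
    (hp2 : p ≠ 2) (hr : W.analyticRank ≤ 1) (hgv : GVPar W p)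
    (Dq : TateParameterData W p) {Dh : PAdicHeightData W p} (hDh : IsSplitMultCanonical Dh Dq)
    {κ : ZpExtension ℚ p} {γ : Field.absoluteGaloisGroup ℚ} (hκ : κ.IsCyclotomic)
    (hγ : κ.IsTopGenerator γ) (hγ' : IsCyclotomicVariable p γ) {N : ℕ} [NeZero N]
    {f : CuspForm (Gamma0 N) 2} (hf : IsNewformOf W f) (D : W.SelmerDualData κ γ) (ϖ : ℚ)
    (hϖ0 : ϖ ≠ 0) (hϖ : (ϖ : ℝ) * W.realPeriodRat = plusPeriod f)
    (L : PowerSeries ℚ_[p]) (hL : IsSplitMultPAdicLFunctionOf f p L) {s : ℚ} (hs : shaAn W = (s : ℂ)) :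
    (L.order = (W.mordellWeilRank + 1 : ℕ) ∧
      (((ϖ : ℚ) : ℚ_[p]) * PowerSeries.coeff (W.mordellWeilRank + 1) L *
          (padicLog p (cyclotomicGenerator p) ^ (W.mordellWeilRank + 1) *
            (W.torsionOrder : ℚ_[p]) ^ 2)).valuation =
        (LInvariant Dq * (W.tamagawaProduct : ℚ_[p]) * padicRegulator Dh).valuation + padicValRat p s)
    ↔ (SchneiderConjecture Dh ∧ BSDp W p) :=
  certificate_iff_schneider_and_bsdp_of_mazurMainConjectureAt_split hJs hGZK W p hp2 hr
    (mazurMainConjectureAt_of_gvPar hGV hWu W p hp2 Dq.split.hasMultiplicativeReductionAtPrime hgv)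
    Dq hDh hκ hγ hγ' hf D ϖ hϖ0 hϖ L hL hs

/-- **X2 ∧ `GVPar`, non-split `p`, analytic rank `≤ 1`: the L3 certificate (with `#Ш_an`) is
EXACT** (as above, non-split clause). [cite: GreenbergVatsal2000, Thm. (1.3) with pp. 1, 14–15]
[cite: Wuthrich2014, Thm. 16 (p. 397)] [cite: SteinWuthrich2013, Thm. 6.1 (p. 20), §3.1, §4.2] -/
theorem certificate_iff_schneider_and_bsdp_of_gvPar_nonsplit (hGV : lambdaMu_multiplicative_of_gvPar)
    (hWu : thm16_charIdeal_dvd_multiplicative_of_reducible)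
    (hJn : thm61_nonsplitMultiplicative) (hGZK : rank_eq_analyticRank_of_analyticRank_le_one)
    (W : WeierstrassCurve ℚ) [W.IsElliptic] [W.IsGloballyMinimal] (p : ℕ) [Fact p.Prime]
    (hp2 : p ≠ 2) (hr : W.analyticRank ≤ 1) (hgv : GVPar W p)
    (hmult : W.HasMultiplicativeReductionAtPrime p) (hns : ¬ W.HasSplitMultiplicativeReductionAtPrime p)
    {q : ℚ_[p]} (hq0 : q ≠ 0) (hq1 : ‖q‖ < 1) (hqj : tateJ q = (W.j : ℚ_[p]))
    {Dh : PAdicHeightData W p} (hDh : IsMultCanonical Dh q)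
    {κ : ZpExtension ℚ p} {γ : Field.absoluteGaloisGroup ℚ} (hκ : κ.IsCyclotomic)
    (hγ : κ.IsTopGenerator γ) (hγ' : IsCyclotomicVariable p γ) {N : ℕ} [NeZero N]
    {f : CuspForm (Gamma0 N) 2} (hf : IsNewformOf W f) (D : W.SelmerDualData κ γ) (ϖ : ℚ)
    (hϖ0 : ϖ ≠ 0) (hϖ : (ϖ : ℝ) * W.realPeriodRat = plusPeriod f)
    (L : PowerSeries ℚ_[p]) (hL : IsMultPAdicLFunctionOf f p (-1) L) {s : ℚ}
    (hs : shaAn W = (s : ℂ)) :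
    (L.order = (W.mordellWeilRank : ℕ) ∧
      (((ϖ : ℚ) : ℚ_[p]) * PowerSeries.coeff W.mordellWeilRank L *
          (padicLog p (cyclotomicGenerator p) ^ W.mordellWeilRank *
            (W.torsionOrder : ℚ_[p]) ^ 2)).valuation =
        (2 * (W.tamagawaProduct : ℚ_[p]) * padicRegulator Dh).valuation + padicValRat p s)
    ↔ (SchneiderConjecture Dh ∧ BSDp W p) :=
  certificate_iff_schneider_and_bsdp_of_mazurMainConjectureAt_nonsplit hJn hGZK W p hp2 hr
    (mazurMainConjectureAt_of_gvPar hGV hWu W p hp2 hmult hgv) hmult hns hq0 hq1 hqj hDh hκ hγ hγ' hf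
    D ϖ hϖ0 hϖ L hL hs

end Exact

end Summit.BirchSwinnertonDyer.Rank1Residual.X2

end
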